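import Mathlib
import Summits.AtomisticToContinuum.Crystallization.Theorems.NashClassCertificatesNashNearFieldStubCauchyBornSitewiseOfCoercivity

/-!
# Route `NashClassCertificates`, crux `NashNearField` (stmt-AtomisticToContinuum-16827), line `birth`:
# pieces for the stub `stub_sitewisePlus` (SITEWISE⁺, the cushioned sitewise landscape bound), I — CBBC + CUSHION ⟹ CBBC⁺

Skeleton v10.2 replaced SITEWISE ⟹ FLUX by SITEWISE⁺ ⟹ FLUX, where SITEWISE⁺ adds the Hägg cushion
`+ (if s (m-1) = s m then cH else 0)` (a c-layer at `m`) on the left of the layer inequality (worker verdict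
`birth-flux-status.md`: the residual layer forces `|J₂′(2h*)| = 6.05·10⁻⁴` of mixed words at uniform spacing are first
order in the non-affinity and only the cushion `|J₂| ≥ 3.6·10⁻⁵` per c-layer pays them).  SITEWISE⁺ is reduced here and in
the companion file `…StubSitewisePlusOfCushion` to two period-average inputs:

* CBBC (registered, `stub_cauchyBornBarlowCoercivity`, derived in the skeleton from LL⅒): for a periodic Hägg word `t`, an
  automorphism `G` in the `4/5–6/5` tube and `r ∈ [0, 1/10]` with `G` `r`-far from the box family on the unit sites of norm
  `≤ 3`, `e⋆ + κ r² ≤ e(G·T_t)`;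
* CUSHION (new, the STRAINED HÄGG CUSHION, hypothesis here; numerically `cH ≈ |J₂(G)| ∈ [3.7, 14]·10⁻⁵` per c-layer for `G`
  within `1/100` of the box family, audit `SITEWISEPLUS_STATUS.md`): if `G` is within `1/100` of some box-scaled isometric
  template on the unit sites of norm `≤ 3`, then `e(G·T_alt) + cH·#{m < p : t(m−1) = t m}/p ≤ e(G·T_t)` — the strained
  stacking of the alternating (hcp) word is below every strained periodic stacking by `cH` per c-layer.

`swp_cbbcPlus` combines them into CBBC⁺ in period-sum form, with constants `κ/200` and `min (cH/2) (κ/20000)`: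
`(e⋆ + (κ/200) r²)·p + Σ_{m<p} [t(m−1) = t m]·min(cH/2, κ/2·10⁴) ≤ Σ_{m<p} S_t(m)` (`S_t(m)` the strained site energy of layer
`m`).  Near the family: CBBC for `t` at `r`, CBBC for the alternating word at `r = 0` (always far-trivially) and CUSHION,
averaged; far from the family (`1/100`-far): CBBC at `r = 1/100` alone pays `κ·10⁻⁴ ≥ (κ/200)r² + κ/(2·10⁴)`.
All `[folklore]` given the two hypotheses.
-/

noncomputable section

open scoped BigOperators
open Literature.MathematicalPhysics.StatisticalMechanics Literature.Geometry.DiscreteGeometry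

namespace Summit.AtomisticToContinuum.Crystallization.Theorems.NashClassCertificatesNashNearField

/-- The alternating Hägg word is `2`-periodic, in the `ℕ`-cast form used by the periodic configurations. [folklore] -/
theorem swp_alt_periodic : ∀ i : ℤ, alternatingHagg (i + ((2 : ℕ) : ℤ)) = alternatingHagg i := fun i => by
  exact_mod_cast alternatingHagg_periodic i

/-- The origin site of the unit template. [folklore] -/
theorem swp_barlowPos_origin (t : ℤ → ℤ) : barlowPos 1 (Real.sqrt 6 / 3) t 0 0 0 = 0 := by
  simp [barlowPos]

/-- Far from the family at level `r = 0` holds trivially (witness: the origin site). [folklore] -/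
theorem swp_famFar_zero (t : ℤ → ℤ) (F : EuclideanSpace ℝ (Fin 3) → EuclideanSpace ℝ (Fin 3)) :
    ∀ (A : EuclideanSpace ℝ (Fin 3) →ₗᵢ[ℝ] EuclideanSpace ℝ (Fin 3)) (a h : ℝ), 47 / 50 ≤ a → a ≤ 1 → 39 / 50 * a ≤ h →
      h ≤ 17 / 20 * a →
      ∃ m u v : ℤ, ‖barlowPos 1 (Real.sqrt 6 / 3) t m u v‖ ≤ 3 ∧
        (0 : ℝ) ≤ dist (F (barlowPos 1 (Real.sqrt 6 / 3) t m u v)) (A (barlowPos a h t m u v)) := by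
  intro A a h _ _ _ _
  exact ⟨0, 0, 0, by rw [swp_barlowPos_origin, norm_zero]; norm_num, dist_nonneg⟩

/-- The c-layer count of a period as an indicator sum. [folklore] -/
theorem swp_card_filter_eq_sum (t : ℤ → ℤ) (P : ℕ) :
    ((((Finset.range P).filter (fun m : ℕ => t ((m : ℤ) - 1) = t m)).card : ℕ) : ℝ) =
      ∑ k ∈ Finset.range P, (if t ((k : ℤ) - 1) = t k then (1 : ℝ) else 0) := by
  rw [Finset.card_filter]
  push_cast
  rfl

/-- Weighted indicator sums: `Σ [c]·μ = μ·Σ [c]`. [folklore] -/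
theorem swp_sum_ite_const (t : ℤ → ℤ) (S : Finset ℕ) (μ : ℝ) :
    ∑ k ∈ S, (if t ((k : ℤ) - 1) = t k then μ else 0) =
      μ * ∑ k ∈ S, (if t ((k : ℤ) - 1) = t k then (1 : ℝ) else 0) := by
  rw [Finset.mul_sum]
  refine Finset.sum_congr rfl fun k _ => ?_
  split_ifs <;> simp

/-- Indicator sums over a period are between `0` and the period. [folklore] -/
theorem swp_sum_ite_bounds (t : ℤ → ℤ) (P : ℕ) :
    0 ≤ ∑ k ∈ Finset.range P, (if t ((k : ℤ) - 1) = t k then (1 : ℝ) else 0) ∧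
      ∑ k ∈ Finset.range P, (if t ((k : ℤ) - 1) = t k then (1 : ℝ) else 0) ≤ P := by
  constructor
  · exact Finset.sum_nonneg fun k _ => by split_ifs <;> norm_num
  · calc ∑ k ∈ Finset.range P, (if t ((k : ℤ) - 1) = t k then (1 : ℝ) else 0)
        ≤ ∑ _k ∈ Finset.range P, (1 : ℝ) := Finset.sum_le_sum fun k _ => by split_ifs <;> norm_num
      _ = P := by simp

/-- **Stub piece `swp_cbbcPlus`: CBBC + CUSHION ⟹ CBBC⁺ in period-sum form (proved).**  From the Cauchy–Born coercivity
CBBC (constant `κ`) and the strained Hägg cushion CUSHION (constant `cH`, nearness `1/100`): for every periodic Hägg word `t`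
(period `P`), every automorphism `G` in the tube, every `r ∈ [0, 1/10]` with `G` `r`-far from the box family on the unit sites of
`T_t` of norm `≤ 3`,
`(e⋆ + (κ/200) r²)·P + Σ_{k<P} [t(k−1) = t k]·min(cH/2, κ/20000) ≤ Σ_{k<P} ½Σ'_q V_LJ(dist(G b_{(k,0,0)}, G b_q))`.
Near the family the three inequalities CBBC(`t`, `r`), CBBC(alt, `0`), CUSHION are averaged; `1/100`-far from it CBBC(`t`, `1/100`)
suffices. [folklore] -/
theorem swp_cbbcPlus {κ cH : ℝ} (hκ : 0 < κ) (hcH : 0 < cH)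
    (hCB : ∀ (s : ℤ → ℤ) (p : ℕ) (hp : p ≠ 0) (hs : ∀ i, s (i + p) = s i), IsHaggSeq s →
      ∀ (G : EuclideanSpace ℝ (Fin 3) ≃L[ℝ] EuclideanSpace ℝ (Fin 3)),
        (∀ v : EuclideanSpace ℝ (Fin 3), 4 / 5 * ‖v‖ ≤ ‖G v‖ ∧ ‖G v‖ ≤ 6 / 5 * ‖v‖) →
        ∀ r : ℝ, 0 ≤ r → r ≤ 1 / 10 →
          (∀ (A : EuclideanSpace ℝ (Fin 3) →ₗᵢ[ℝ] EuclideanSpace ℝ (Fin 3)) (a h : ℝ), 47 / 50 ≤ a → a ≤ 1 → 39 / 50 * a ≤ h → h ≤ 17 / 20 * a →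
            ∃ m u v : ℤ, ‖barlowPos 1 (Real.sqrt 6 / 3) s m u v‖ ≤ 3 ∧
              r ≤ dist (G (barlowPos 1 (Real.sqrt 6 / 3) s m u v)) (A (barlowPos a h s m u v))) →
          (⨅ Q : PeriodicConfiguration 3, Q.energyPerParticle lennardJones) + κ * r ^ 2 ≤
            ((barlowPeriodicConfiguration s one_ne_zero sw_h0_ne hp hs).linearImage G).energyPerParticle lennardJones)
    (hCU : ∀ (s : ℤ → ℤ) (p : ℕ) (hp : p ≠ 0) (hs : ∀ i, s (i + p) = s i), IsHaggSeq s →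
      ∀ (G : EuclideanSpace ℝ (Fin 3) ≃L[ℝ] EuclideanSpace ℝ (Fin 3)),
        (∀ v : EuclideanSpace ℝ (Fin 3), 4 / 5 * ‖v‖ ≤ ‖G v‖ ∧ ‖G v‖ ≤ 6 / 5 * ‖v‖) →
        (∃ (A : EuclideanSpace ℝ (Fin 3) →ₗᵢ[ℝ] EuclideanSpace ℝ (Fin 3)) (a h : ℝ), 47 / 50 ≤ a ∧ a ≤ 1 ∧ 39 / 50 * a ≤ h ∧
            h ≤ 17 / 20 * a ∧ ∀ m u v : ℤ, ‖barlowPos 1 (Real.sqrt 6 / 3) s m u v‖ ≤ 3 →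
              dist (G (barlowPos 1 (Real.sqrt 6 / 3) s m u v)) (A (barlowPos a h s m u v)) < 1 / 100) →
        ((barlowPeriodicConfiguration alternatingHagg one_ne_zero sw_h0_ne two_ne_zero swp_alt_periodic).linearImage
              G).energyPerParticle lennardJones +
            cH * (((Finset.range p).filter (fun m : ℕ => s ((m : ℤ) - 1) = s m)).card : ℝ) / p ≤
          ((barlowPeriodicConfiguration s one_ne_zero sw_h0_ne hp hs).linearImage G).energyPerParticle lennardJones)
    (t : ℤ → ℤ) (P : ℕ) (hP : P ≠ 0) (ht : ∀ i, t (i + P) = t i) (htH : IsHaggSeq t)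
    (G' : EuclideanSpace ℝ (Fin 3) ≃L[ℝ] EuclideanSpace ℝ (Fin 3))
    (hG' : ∀ v : EuclideanSpace ℝ (Fin 3), 4 / 5 * ‖v‖ ≤ ‖G' v‖ ∧ ‖G' v‖ ≤ 6 / 5 * ‖v‖)
    {r : ℝ} (hr0 : 0 ≤ r) (hr1 : r ≤ 1 / 10)
    (hfar : ∀ (A : EuclideanSpace ℝ (Fin 3) →ₗᵢ[ℝ] EuclideanSpace ℝ (Fin 3)) (a h : ℝ), 47 / 50 ≤ a → a ≤ 1 → 39 / 50 * a ≤ h → h ≤ 17 / 20 * a →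
      ∃ m u v : ℤ, ‖barlowPos 1 (Real.sqrt 6 / 3) t m u v‖ ≤ 3 ∧
        r ≤ dist (G' (barlowPos 1 (Real.sqrt 6 / 3) t m u v)) (A (barlowPos a h t m u v))) :
    ((⨅ Q : PeriodicConfiguration 3, Q.energyPerParticle lennardJones) + κ / 200 * r ^ 2) * (P : ℝ) +
        ∑ k ∈ Finset.range P, (if t ((k : ℤ) - 1) = t k then min (cH / 2) (κ / 20000) else 0) ≤
      ∑ k ∈ Finset.range P, (1 / 2 : ℝ) * ∑' q : ℤ × ℤ × ℤ,
        lennardJones (dist (G' (barlowPos 1 (Real.sqrt 6 / 3) t k 0 0)) (G' (barlowPos 1 (Real.sqrt 6 / 3) t q.1 q.2.1 q.2.2))) := by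
  have hPpos : (0 : ℝ) < (P : ℝ) := by exact_mod_cast Nat.pos_of_ne_zero hP
  have hid := energyPerParticle_linearImage_barlow_eq_average lennardJones lennardJones_zero one_pos
    cbbc_sqrt_six_div_three_pos one_ne_zero sw_h0_ne hP ht G'
  set X : ℝ := ∑ k ∈ Finset.range P, (1 / 2 : ℝ) * ∑' q : ℤ × ℤ × ℤ,
        lennardJones (dist (G' (barlowPos 1 (Real.sqrt 6 / 3) t k 0 0)) (G' (barlowPos 1 (Real.sqrt 6 / 3) t q.1 q.2.1 q.2.2)))
    with hX
  set E : ℝ := (⨅ Q : PeriodicConfiguration 3, Q.energyPerParticle lennardJones) with hE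
  set μ : ℝ := min (cH / 2) (κ / 20000) with hμ
  set C : ℝ := ∑ k ∈ Finset.range P, (if t ((k : ℤ) - 1) = t k then (1 : ℝ) else 0) with hC
  obtain ⟨hC0, hCP⟩ := swp_sum_ite_bounds t P
  rw [← hC] at hC0 hCP
  have hμ1 : μ ≤ cH / 2 := min_le_left _ _
  have hμ2 : μ ≤ κ / 20000 := min_le_right _ _
  have hμ0 : 0 ≤ μ := le_min (by linarith) (by linarith)
  rw [swp_sum_ite_const t (Finset.range P) μ, ← hC]
  have hr2 : 0 ≤ r ^ 2 := sq_nonneg r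
  by_cases hnear : ∃ (A : EuclideanSpace ℝ (Fin 3) →ₗᵢ[ℝ] EuclideanSpace ℝ (Fin 3)) (a h : ℝ), 47 / 50 ≤ a ∧ a ≤ 1 ∧
      39 / 50 * a ≤ h ∧ h ≤ 17 / 20 * a ∧ ∀ m u v : ℤ, ‖barlowPos 1 (Real.sqrt 6 / 3) t m u v‖ ≤ 3 →
        dist (G' (barlowPos 1 (Real.sqrt 6 / 3) t m u v)) (A (barlowPos a h t m u v)) < 1 / 100
  · -- near the family: average CBBC(t, r) with CBBC(alt, 0) + CUSHION
    have h1 := hCB t P hP ht htH G' hG' r hr0 hr1 hfar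
    have h2 := hCB alternatingHagg 2 two_ne_zero swp_alt_periodic isHaggSeq_alternating G' hG' 0 le_rfl (by norm_num)
      (swp_famFar_zero alternatingHagg G')
    have h3 := hCU t P hP ht htH G' hG' hnear
    rw [hid] at h1 h3
    rw [swp_card_filter_eq_sum t P, ← hC] at h3
    set A : ℝ := ((barlowPeriodicConfiguration alternatingHagg one_ne_zero sw_h0_ne two_ne_zero
      swp_alt_periodic).linearImage G').energyPerParticle lennardJones with hA
    have h1' := (le_div_iff₀ hPpos).1 h1
    have h3' := (le_div_iff₀ hPpos).1 h3
    have h3'' : A * (P : ℝ) + cH * C ≤ X := by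
      have hcalc : (A + cH * C / (P : ℝ)) * (P : ℝ) = A * (P : ℝ) + cH * C := by
        field_simp
      linarith [hcalc]
    have h2' : E ≤ A := by
      have : κ * (0 : ℝ) ^ 2 = 0 := by ring
      linarith
    have hEA : E * (P : ℝ) ≤ A * (P : ℝ) := mul_le_mul_of_nonneg_right h2' hPpos.le
    have hμC : μ * C ≤ cH / 2 * C := mul_le_mul_of_nonneg_right hμ1 hC0
    have hκP : κ / 200 * (r ^ 2 * (P : ℝ)) ≤ κ / 2 * (r ^ 2 * (P : ℝ)) := by
      apply mul_le_mul_of_nonneg_right _ (by positivity)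
      linarith
    nlinarith [h1', h3'', hEA, hμC, hκP]
  · -- far from the family: CBBC at `r = 1/100`
    push Not at hnear
    have h1 := hCB t P hP ht htH G' hG' (1 / 100) (by norm_num) (by norm_num) hnear
    rw [hid] at h1
    have h1' := (le_div_iff₀ hPpos).1 h1
    have hrr : r ^ 2 ≤ 1 / 100 := by nlinarith
    have hA : κ / 200 * r ^ 2 * (P : ℝ) ≤ κ / 20000 * (P : ℝ) := by
      apply mul_le_mul_of_nonneg_right _ hPpos.le
      nlinarith
    have hB : μ * C ≤ κ / 20000 * (P : ℝ) :=
      calc μ * C ≤ μ * (P : ℝ) := mul_le_mul_of_nonneg_left hCP hμ0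
        _ ≤ κ / 20000 * (P : ℝ) := mul_le_mul_of_nonneg_right hμ2 hPpos.le
    have hexp : (E + κ * (1 / 100) ^ 2) * (P : ℝ) = E * (P : ℝ) + κ / 20000 * (P : ℝ) + κ / 20000 * (P : ℝ) := by ring
    nlinarith [h1', hA, hB, hexp]

end Summit.AtomisticToContinuum.Crystallization.Theorems.NashClassCertificatesNashNearField

end
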